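import Literature.Probability.LatticeModels.ProductMeasureFoldings
import Literature.Probability.LatticeModels.IsoradialPercolation
import Literature.Probability.Percolation.Percolation
import HarnessLib

/-!
# The SHARP reverse-Harris row `P3_{2/3}` from its switching (fibre / class-count) form

Support file for crux `stmt-CriticalPhenomena-4575` (`NoHeavyLowerTail`), seat `prim-l12-p1` gen 28
(`--supports stmt-CriticalPhenomena-4575`); memo `run/shared/lean/prim/prim-l12/FROM-prim-l12-p1-g28-FIBRE-P3-TWO-THIRDS.md`.
No definitions, no sorries, standard axioms.  Companion of `…LowerTailP3HalfOfFibre` (gen 27).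

Bond percolation `μ = prodBernoulli w` on a finite vertex type, four vertices `s a b c`; `F = (s↔a) ∩ (s↔b)ᶜ`,
`CT = c ↔ {s,a,b} = ((c↔s)ᶜ ∩ (c↔a)ᶜ ∩ (c↔b)ᶜ)ᶜ`.  Gen 27 reduced the row `P3_{1/2}`: `μ(F)·μ(CT) ≤ 2·μ(F ∩ CT)` to the
classwise ("fibre") count `#{y ∈ F, y^Δ ∈ CT} ≤ 2·#{y ∈ F ∩ CT}` in every folding of the pattern cube.  The gen-28 census
(memo §1) shows that the fibre counts in fact satisfy the SHARP inequality

  `2 · #{y ∈ fibre Δ u | y ∈ F, y^Δ ∈ CT} ≤ 3 · #{y ∈ fibre Δ u | y ∈ F ∩ CT}`      (FIBRE-P3⅔, conjecture)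

on every support tested (all multigraphs with ≤ 5 vertices and ≤ 7 edges, random multigraphs to 8 vertices / 11 edges,
3-point and 4-point), with equality on the all-ones fibre whenever the port `c` is a series vertex `s–c–b`; `3/2` is the
exact maximum of the ratio.  Summed with the folding weights this is the value-level row with the conjectured SHARP constant,
`P3_{2/3}`: `2·μ(F)·μ(CT) ≤ 3·μ(F ∩ CT)`, i.e. `P(c ↔ {s,a,b} | s∼a, s≁b) ≥ ⅔·P(c ↔ {s,a,b})` — at three points (`a = s`) this
is the face `(C½)` of the sextic law, a theorem of the lane (`…ThreePointIsoSexticUniversal`), at four points it is the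
conjectured sharp form of `P3_{1/2}`.  This file is the kernel form of the implication FIBRE-P3⅔ ⟹ P3_{2/3} (and, generally,
of `a·#L ≤ b·#R` classwise ⟹ `a·P(A)P(B) ≤ b·P(C)`):
* `sum_pair_le_of_classCount_le₂` — the folding principle with constant factors on BOTH sides;
* `prodBernoulli_pair_le_of_classCount_le₂` — transported to `prodBernoulli p` for events determined by a finite set;
* `p3_twoThirds_of_fibreCount` — **FIBRE-P3⅔ ⟹ P3_{2/3}** on the given finite weighted graph.
-/

noncomputable section

namespace Summit.CriticalPhenomena.PercolationContinuityZ3.Theorems.P3TwoThirdsOfFibre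

open MeasureTheory Set Finset
open Literature.Probability.Percolation Literature.Probability.LatticeModels
open Literature.Probability.LatticeModels.Folding

/-! ### The folding principle with factors on both sides -/

section Folding

variable {α : Type*} [Fintype α] [DecidableEq α]

/-- **Folding principle with two factors.**  If in every folding `(Δ, u)` of the cube `{0,1}^α` the folded pairs `(y, y^Δ)`
satisfy `a · #{L} ≤ b · #{R}`, then `a · ∑_y ∑_x W(y) W(x) 𝟙[L(y,x)] ≤ b · ∑_y ∑_x W(y) W(x) 𝟙[R(y,x)]` for every product
weight `w ≥ 0` (a product weight is uniform on every folding, so each pair sum is a positive combination of class counts).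
[cite: VandenbergGandolfi2012, proof of Thm. 13 and Lemma 14] -/
theorem sum_pair_le_of_classCount_le₂ (w : α → Bool → ℝ) (hw : ∀ i b, 0 ≤ w i b)
    (L R : (α → Bool) → (α → Bool) → Prop) [∀ x y, Decidable (L x y)] [∀ x y, Decidable (R x y)]
    (a b : ℕ) (h : ∀ (Δ : Finset α) (u : α → Bool), a * classCount Δ u L ≤ b * classCount Δ u R) :
    (a : ℝ) * ∑ y : α → Bool, ∑ x : α → Bool, wt w y * wt w x * (if L y x then 1 else 0) ≤
      (b : ℝ) * ∑ y : α → Bool, ∑ x : α → Bool, wt w y * wt w x * (if R y x then 1 else 0) := by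
  rw [sum_pair_eq_sum_foldings w fun y x => if L y x then (1 : ℝ) else 0,
    sum_pair_eq_sum_foldings w fun y x => if R y x then (1 : ℝ) else 0, Finset.mul_sum, Finset.mul_sum]
  refine Finset.sum_le_sum fun Δ _ => ?_
  rw [Finset.mul_sum, Finset.mul_sum]
  refine Finset.sum_le_sum fun u _ => ?_
  rw [sum_fibre_boole_eq_classCount, sum_fibre_boole_eq_classCount]
  have hW : 0 ≤ wt w u * wt w (flipOn Δ u) := mul_nonneg (wt_nonneg hw _) (wt_nonneg hw _)
  have hk : (a : ℝ) * (classCount Δ u L : ℝ) ≤ (b : ℝ) * (classCount Δ u R : ℝ) := by exact_mod_cast h Δ u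
  calc (a : ℝ) * (wt w u * wt w (flipOn Δ u) * (classCount Δ u L : ℝ))
      = wt w u * wt w (flipOn Δ u) * ((a : ℝ) * (classCount Δ u L : ℝ)) := by ring
    _ ≤ wt w u * wt w (flipOn Δ u) * ((b : ℝ) * (classCount Δ u R : ℝ)) :=
        mul_le_mul_of_nonneg_left hk hW
    _ = (b : ℝ) * (wt w u * wt w (flipOn Δ u) * (classCount Δ u R : ℝ)) := by ring

end Folding

/-! ### Transport to the product Bernoulli measure -/

section ProdBernoulli

variable {ι : Type*}

/-- **Two-layer rows of `prodBernoulli p` from classwise certificates with two factors.**  Let `A, B, C` be events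
determined by a finite set `F`; if on the pattern cube `{0,1}^F`, in every folding `(Δ, u)`, `a` times the number of patterns
`y` of the fibre with `{y} ∈ A, {y^Δ} ∈ B` is at most `b` times the number of patterns with `{y} ∈ C` (`{y} = cubeCfg F y`), then
for EVERY parameter `p : ι → [0,1]`, `a · P(A) · P(B) ≤ b · P(C)`.
[cite: VandenbergGandolfi2012, proof of Thm. 13 and Lemma 14] -/
theorem prodBernoulli_pair_le_of_classCount_le₂ [DecidableEq ι] (p : ι → unitInterval)
    (F : Finset ι) {A B C : Set (Set ι)}
    [DecidablePred (· ∈ A)] [DecidablePred (· ∈ B)] [DecidablePred (· ∈ C)]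
    (hA : DeterminedBy A (↑F : Set ι)) (hB : DeterminedBy B (↑F : Set ι)) (hC : DeterminedBy C (↑F : Set ι))
    (a b : ℕ)
    (h : ∀ (Δ : Finset F) (u : F → Bool),
      a * ((Folding.fibre Δ u).filter fun y =>
          cubeCfg F y ∈ A ∧ cubeCfg F (Folding.flipOn Δ y) ∈ B).card ≤
        b * ((Folding.fibre Δ u).filter fun y => cubeCfg F y ∈ C).card) :
    a * ((prodBernoulli p).real A * (prodBernoulli p).real B) ≤ b * (prodBernoulli p).real C := by
  set w : F → Bool → ℝ := fun i b =>
    if b = true then ((p i : unitInterval) : ℝ) else 1 - ((p i : unitInterval) : ℝ) with hw_def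
  have hw : ∀ i b, 0 ≤ w i b := by
    intro i b
    simp only [hw_def]
    split_ifs
    · exact (p i).2.1
    · exact sub_nonneg.2 (p i).2.2
  -- total mass: `1 = P(univ) = ∑_x W(x)`
  have htot : ∑ x : F → Bool, wt w x = 1 := by
    have hu := prodBernoulli_real_eq_sum_indicator_wt p F (determinedBy_univ (↑F : Set ι))
    rw [probReal_univ, Set.preimage_univ] at hu
    rw [hu]
    refine Finset.sum_congr rfl fun x _ => ?_
    rw [Set.indicator_of_mem (Set.mem_univ _)]
  rw [prodBernoulli_real_eq_sum_indicator_wt p F hA, prodBernoulli_real_eq_sum_indicator_wt p F hB,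
    prodBernoulli_real_eq_sum_indicator_wt p F hC]
  letI : DecidablePred (· ∈ cubeCfg F ⁻¹' A) := fun y => ‹DecidablePred (· ∈ A)› (cubeCfg F y)
  letI : DecidablePred (· ∈ cubeCfg F ⁻¹' B) := fun y => ‹DecidablePred (· ∈ B)› (cubeCfg F y)
  letI : DecidablePred (· ∈ cubeCfg F ⁻¹' C) := fun y => ‹DecidablePred (· ∈ C)› (cubeCfg F y)
  have e1 : (∑ x : F → Bool, (cubeCfg F ⁻¹' A).indicator (wt w) x) *
      ∑ x : F → Bool, (cubeCfg F ⁻¹' B).indicator (wt w) x =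
      ∑ y : F → Bool, ∑ x : F → Bool,
        wt w y * wt w x * (if cubeCfg F y ∈ A ∧ cubeCfg F x ∈ B then 1 else 0) := by
    rw [Finset.sum_mul_sum]
    refine Finset.sum_congr rfl fun y _ => Finset.sum_congr rfl fun x _ => ?_
    by_cases hy : cubeCfg F y ∈ A <;> by_cases hx : cubeCfg F x ∈ B <;>
      simp [Set.indicator, Set.mem_preimage, hy, hx]
  have e2 : (∑ x : F → Bool, (cubeCfg F ⁻¹' C).indicator (wt w) x) =
      ∑ y : F → Bool, ∑ x : F → Bool,
        wt w y * wt w x * (if cubeCfg F y ∈ C then 1 else 0) := by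
    have : (∑ x : F → Bool, (cubeCfg F ⁻¹' C).indicator (wt w) x) =
        (∑ x : F → Bool, (cubeCfg F ⁻¹' C).indicator (wt w) x) * ∑ x : F → Bool, wt w x := by
      rw [htot, mul_one]
    rw [this, Finset.sum_mul_sum]
    refine Finset.sum_congr rfl fun y _ => Finset.sum_congr rfl fun x _ => ?_
    by_cases hy : cubeCfg F y ∈ C <;> simp [Set.indicator, Set.mem_preimage, hy]
  rw [e1, e2]
  refine sum_pair_le_of_classCount_le₂ w hw
    (fun y x => cubeCfg F y ∈ A ∧ cubeCfg F x ∈ B) (fun y _ => cubeCfg F y ∈ C) a b ?_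
  intro Δ u
  rw [classCount_eq, classCount_eq]
  exact h Δ u

end ProdBernoulli

/-! ### `FIBRE-P3⅔ ⟹ P3_{2/3}` -/

section Percolation

open scoped Classical

variable {V : Type*} [Fintype V]

/-- **FIBRE-P3⅔ ⟹ P3_{2/3} (the sharp reverse-Harris row).**  Let `μ = prodBernoulli w` on a finite vertex type,
`s a b c : V`, `F = (s↔a) ∩ (s↔b)ᶜ`, `CT = c ↔ {s,a,b} = ((c↔s)ᶜ ∩ (c↔a)ᶜ ∩ (c↔b)ᶜ)ᶜ`.  If the sharp switching form of the
reverse-Harris row holds on this support — in every folding `(Δ, u)` of the pattern cube over ALL pairs, twice the number of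
patterns `y` with `{y} ∈ F` and `{y^Δ} ∈ CT` is at most three times the number of patterns with `{y} ∈ F ∩ CT` — then
`2 · μ(F) · μ(CT) ≤ 3 · μ(F ∩ CT)` for every weight vector `w`, i.e. `P(c ↔ {s,a,b} | s∼a, s≁b) ≥ ⅔ · P(c ↔ {s,a,b})`
(the hypothesis of `IncStar.oneSided_of_superTerminal` with `κ = ⅔`).  The case `a = s` is the 3-point row
`3μ(s≁b, c↔{s,b}) ≥ 2μ(s≁b)μ(c↔{s,b})`, equivalent to the face `(C½)` of the lane. [this work] -/
theorem p3_twoThirds_of_fibreCount (w : Sym2 V → unitInterval) (s a b c : V)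
    (h : ∀ (Δ : Finset (↥(Finset.univ : Finset (Sym2 V)))) (u : (↥(Finset.univ : Finset (Sym2 V))) → Bool),
      2 * ((Folding.fibre Δ u).filter fun y =>
          cubeCfg Finset.univ y ∈ (openConn s a ∩ (openConn s b)ᶜ : Set (BondConfig V)) ∧
            cubeCfg Finset.univ (Folding.flipOn Δ y) ∈
              (((openConn c s)ᶜ ∩ (openConn c a)ᶜ ∩ (openConn c b)ᶜ)ᶜ : Set (BondConfig V))).card ≤
        3 * ((Folding.fibre Δ u).filter fun y =>
          cubeCfg Finset.univ y ∈
            (openConn s a ∩ (openConn s b)ᶜ ∩ ((openConn c s)ᶜ ∩ (openConn c a)ᶜ ∩ (openConn c b)ᶜ)ᶜ :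
              Set (BondConfig V))).card) :
    2 * ((prodBernoulli w).real (openConn s a ∩ (openConn s b)ᶜ : Set (BondConfig V)) *
        (prodBernoulli w).real ((openConn c s)ᶜ ∩ (openConn c a)ᶜ ∩ (openConn c b)ᶜ : Set (BondConfig V))ᶜ) ≤
      3 * (prodBernoulli w).real
        (openConn s a ∩ (openConn s b)ᶜ ∩ ((openConn c s)ᶜ ∩ (openConn c a)ᶜ ∩ (openConn c b)ᶜ)ᶜ : Set (BondConfig V)) := by
  -- every event is determined by the full (finite) index set
  have hdet : ∀ X : Set (Set (Sym2 V)), DeterminedBy X (↑(Finset.univ : Finset (Sym2 V)) : Set (Sym2 V)) := by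
    intro X
    rw [determinedBy_iff]
    intro ω ω' hω
    rw [Finset.coe_univ, Set.inter_univ, Set.inter_univ] at hω
    rw [hω]
  have key := prodBernoulli_pair_le_of_classCount_le₂ (ι := Sym2 V) w Finset.univ
    (A := (openConn s a ∩ (openConn s b)ᶜ : Set (BondConfig V)))
    (B := (((openConn c s)ᶜ ∩ (openConn c a)ᶜ ∩ (openConn c b)ᶜ)ᶜ : Set (BondConfig V)))
    (C := (openConn s a ∩ (openConn s b)ᶜ ∩ ((openConn c s)ᶜ ∩ (openConn c a)ᶜ ∩ (openConn c b)ᶜ)ᶜ :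
      Set (BondConfig V)))
    (hdet _) (hdet _) (hdet _) 2 3
    (by
      intro Δ u
      convert h Δ u using 2)
  exact_mod_cast key

end Percolation

end Summit.CriticalPhenomena.PercolationContinuityZ3.Theorems.P3TwoThirdsOfFibre

end
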